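/-
Origin: expansion seat `planner-pub-hodgecm-mc-axioms-1-g14-0`, handover #W220 2026-08-20T15:53:55Z md5 f716d551f094 (PKG 5ca53bbe858c → f716d551f094; 332 l.; MECHANICAL (iib-R) rewrite v3.1 of the PKG file as it stands (21 token edits; rules R1x2+RX[h₂]x19)) (`HOME/mc/pub-hodgecm-mc-axioms-1-g14/revendor/kit-r55/stage55/HodgeCM/Model/Binders/Real34Seesaw.lean`, md5 f716d551f094, 332 lines);
landed by the gen-22 packager (p-g22) in gate run 55 REPLACES the earlier landed copy of `HodgeCM/Model/Binders/Real34Seesaw.lean` (seat copy carried the packager Origin header of an earlier run (stripped)).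
-/
/-
Origin: speedrun cell pub-hodgecm, MODEL-CONSTRUCTION sub-cell, unit pub-hodgecm-mc-binder-1-g6 (BINDER PROVER, gen 6; node
B2-meet, BINDER-OWNERS row 15 `real34`: the see-saw half of `QautCore.decomp`), seat prover-pub-hodgecm-mc-binder-1-g6-0, 2026-08-19.
Target in PKG: HodgeCM/Model/Binders/Real34Seesaw.lean (NEW additive leaf; imports `Model/Binders/MeetBridgesSeesaw` (kit #5);
nothing landed imports it).  KERNEL ONLY: `SeesawHyp34` is a HYPOTHESIS record; 0 records of published theorems, nothing cited, MODEL-N 0.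
-/
import Summits.HodgeConjecture.HodgeCM.Model.Binders.MeetBridgesSeesaw

/-!
# The (34) torus period of the W-block and the see-saw on PURE TENSORS for E's generator `ϑ₃₄(χ, Φ)`

Row 15 `real34` of E reduces (gen-2 `Real34FunBridge.ofQautCore`, `Binders/MeetBridgesShells`) to a `QautCore` at the pin whose field
`decomp` starts from «(eq:seesaw) on pure tensors» for the (34) block: the model generator `ϑ₃₄(χ₂ ⊠ χ₃, τ φ₂ φ₃)` at `xΓ_U` IS (a constant
times) the PRODUCT of the two scalar theta lifts of `φ₂`, `φ₃` along the CONJUGATED torus `jT₃₄ t = g (u₁ ⊕ u₂) g⁻¹` (`g = c.D.isoGL`).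
This file is the (34) twin of `Gen12TorusPeriodW` + `MeetBridgesSeesaw` §§2–3:

* §1 `thetaW₃₄ W Ψ x t := Θ(W.ρ(eV x⁻¹, eW (jT₃₄ t)) Ψ)`, its descent `thetaWQ₃₄ W Ψ x ∈ C([T], ℂ)` (`W.hρ`, `W.hrat`, `rat_le_comap_jT₃₄`),
  §2 `torusPeriodW₃₄ W χ Ψ x` (linear in `Ψ`), §3 the junction **`t34_ϑc_mk_eq_smul_torusPeriodW₃₄`** with kit #3's (34) block;
* §4 `SeesawHyp34 = {τ, seesaw}` — (SS₃₄) `Θ_W(W.ρ(eV g, eW (jT₃₄ t)) (τ φ₂ φ₃)) = Θ₃(P₂.ω(g, t₁) φ₂) · Θ₃(P₃.ω(g, t₂) φ₃)` (PerL (eq:seesaw)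
  for the conjugated pair; tree #22 `UnitaryDualPairSeesawConjThetaProduct` / #25; producer: period-1's (S-restr) lines `k = 2, 3`), and
  **`integral_mul_integral_eq_torusPeriodW₃₄`**, **`t34_ϑc_mk_eq_smul_integral_mul_integral`**: for `Φ = τ φ₂ φ₃ ∈ 𝒮^κ` and
  `χ = χ₂ ⊠ χ₃` of the (34) type, `ϑc₃₄ χ Φ (xΓ_U) = ν_T(𝓕_T) · (∫ θ_φ₂(xΓ_U, q⁻¹) χ₂(q) dq) · (∫ θ_φ₃(xΓ_U, q⁻¹) χ₃(q) dq)` — by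
  `coord_thetaForm_eq_integral` (kit #5, any `k`) the two factors are coordinates of generating theta forms of types `2`, `3`.
Nothing here is a claim of the manuscripts under adjudication; the K-type / `𝔭₊`-projection half of `decomp` is binder-2's shell.
-/

set_option autoImplicit false

noncomputable section

open MeasureTheory NumberField
open scoped InnerProductSpace ENNReal

attribute [-instance] Quotient.instMeasurableSpace

namespace HodgeCM.Model

open HodgeCM HodgeCM.Universe HodgeCM.PerL34.Annihilation
open Literature.NumberTheory.Weil1964
open Literature.NumberTheory.Automorphic (piSchwartzBruhat)

section General

variable {L : CMField} {ι₁ : L →+* ℂ} {V : HermSpace3 L ι₁} {D : StubTree.SeesawDatum L} (W : WmInput V D)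

local notation3 "L⁺" => maximalRealSubfield (L : Type)

/-! ## 1. The W-block's theta value along the (34) torus -/

/-- `θ^W_Ψ(x, t) := Θ(W.ρ(eV x⁻¹, eW (jT₃₄ t)) Ψ)` — the W-block's kernel at a point of `U(V)(𝔸)` and a point of the (34) torus
`T(𝔸)`, for EVERY `Ψ ∈ 𝒮(𝔸)` (the kernel-model convention of `wmOf'_θ_mk`). -/
def thetaW₃₄ (Ψ : piSchwartzBruhat W.F W.ι) (x : ↥(Adelic.adelicUnitaryGroup L V.Hm)) (t : SeesawTorus L⁺ L) : ℂ :=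
  thetaDistLM W.F W.ι ((W.ρ (W.eV x⁻¹, W.eW (D.jT₃₄ t)) : Module.End ℂ (piSchwartzBruhat W.F W.ι)) Ψ)

/-- (Ported verbatim from the HodgeCMPerL package; no docstring in the source.) -/
theorem thetaW₃₄_apply (Ψ : piSchwartzBruhat W.F W.ι) (x : ↥(Adelic.adelicUnitaryGroup L V.Hm)) (t : SeesawTorus L⁺ L) :
    thetaW₃₄ W Ψ x t = thetaDistLM W.F W.ι ((W.ρ (W.eV x⁻¹, W.eW (D.jT₃₄ t)) : Module.End ℂ (piSchwartzBruhat W.F W.ι)) Ψ) :=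
  rfl

/-- (Ported verbatim from the HodgeCMPerL package; no docstring in the source.) -/
theorem thetaW₃₄_add (Ψ Ψ' : piSchwartzBruhat W.F W.ι) (x : ↥(Adelic.adelicUnitaryGroup L V.Hm)) (t : SeesawTorus L⁺ L) :
    thetaW₃₄ W (Ψ + Ψ') x t = thetaW₃₄ W Ψ x t + thetaW₃₄ W Ψ' x t := by
  simp only [thetaW₃₄_apply, map_add]

/-- (Ported verbatim from the HodgeCMPerL package; no docstring in the source.) -/
theorem thetaW₃₄_smul (a : ℂ) (Ψ : piSchwartzBruhat W.F W.ι) (x : ↥(Adelic.adelicUnitaryGroup L V.Hm)) (t : SeesawTorus L⁺ L) :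
    thetaW₃₄ W (a • Ψ) x t = a * thetaW₃₄ W Ψ x t := by
  simp only [thetaW₃₄_apply, map_smul, smul_eq_mul]

/-- continuity in the torus variable (Weil's majorants `W.hρ` + continuity of `eW`, `jT₃₄`). -/
theorem continuous_thetaW₃₄ (Ψ : piSchwartzBruhat W.F W.ι) (x : ↥(Adelic.adelicUnitaryGroup L V.Hm)) :
    Continuous (thetaW₃₄ W Ψ x) :=
  (W.hρ.continuous_thetaDistLM Ψ).comp (continuous_const.prodMk (W.heW.comp D.jT₃₄.continuous))

/-- `T(L₀)`-invariance: `θ^W_Ψ(x, γ t) = θ^W_Ψ(x, t)` for `γ ∈ T(L₀)` (`ρ(1, eW (jT₃₄ γ))` fixes `Θ`: `W.hrat` + `W.hΓW` + `jT₃₄(T(L₀)) ⊆ U(W)(L₀)`). -/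
theorem thetaW₃₄_rat_mul (Ψ : piSchwartzBruhat W.F W.ι) (x : ↥(Adelic.adelicUnitaryGroup L V.Hm)) {γ : SeesawTorus L⁺ L}
    (hγ : γ ∈ SeesawTorus.rat L⁺ L) (t : SeesawTorus L⁺ L) : thetaW₃₄ W Ψ x (γ * t) = thetaW₃₄ W Ψ x t := by
  have hΓ : W.eW (D.jT₃₄ γ) ∈ W.Γ := W.hΓW _ (D.rat_le_comap_jT₃₄ hγ)
  have hstab := (mem_thetaStabilizer_iff _).1 (W.hrat 1 W.ΓU.one_mem _ hΓ)
  rw [thetaW₃₄_apply, thetaW₃₄_apply, map_mul, map_mul]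
  have hsplit : ((W.eV x⁻¹, W.eW (D.jT₃₄ γ) * W.eW (D.jT₃₄ t)) : W.GU × W.G) =
      ((1 : W.GU), W.eW (D.jT₃₄ γ)) * (W.eV x⁻¹, W.eW (D.jT₃₄ t)) := by
    rw [Prod.mk_mul_mk, one_mul]
  rw [hsplit, map_mul, Units.val_mul, Module.End.mul_apply]
  exact hstab _

/-- `θ^W_Ψ(x, ·)` is constant on `T(L₀)`-cosets. -/
theorem thetaW₃₄_eq_of_mk_eq (Ψ : piSchwartzBruhat W.F W.ι) (x : ↥(Adelic.adelicUnitaryGroup L V.Hm)) {t t' : SeesawTorus L⁺ L}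
    (h : (QuotientGroup.mk t : SeesawTorus L⁺ L ⧸ SeesawTorus.rat L⁺ L) = QuotientGroup.mk t') :
    thetaW₃₄ W Ψ x t = thetaW₃₄ W Ψ x t' := by
  have hmem : t⁻¹ * t' ∈ SeesawTorus.rat L⁺ L := QuotientGroup.eq.mp h
  have ht' : t' = (t⁻¹ * t') * t := by rw [mul_comm, ← mul_assoc, mul_inv_cancel, one_mul]
  rw [ht', thetaW₃₄_rat_mul W Ψ x hmem]

/-- **The descended kernel** `θ^W_Ψ(x, ·) ∈ C([T], ℂ)`. -/
def thetaWQ₃₄ (Ψ : piSchwartzBruhat W.F W.ι) (x : ↥(Adelic.adelicUnitaryGroup L V.Hm)) :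
    C(SeesawTorus L⁺ L ⧸ SeesawTorus.rat L⁺ L, ℂ) where
  toFun := Quotient.lift (thetaW₃₄ W Ψ x) fun _ _ hab => thetaW₃₄_eq_of_mk_eq W Ψ x (Quotient.sound hab)
  continuous_toFun := (continuous_thetaW₃₄ W Ψ x).quotient_lift _

/-- (Ported verbatim from the HodgeCMPerL package; no docstring in the source.) -/
@[simp] theorem thetaWQ₃₄_mk (Ψ : piSchwartzBruhat W.F W.ι) (x : ↥(Adelic.adelicUnitaryGroup L V.Hm)) (t : SeesawTorus L⁺ L) :
    thetaWQ₃₄ W Ψ x (QuotientGroup.mk t) = thetaW₃₄ W Ψ x t := rfl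

/-- (Ported verbatim from the HodgeCMPerL package; no docstring in the source.) -/
theorem thetaWQ₃₄_add (Ψ Ψ' : piSchwartzBruhat W.F W.ι) (x : ↥(Adelic.adelicUnitaryGroup L V.Hm)) :
    thetaWQ₃₄ W (Ψ + Ψ') x = thetaWQ₃₄ W Ψ x + thetaWQ₃₄ W Ψ' x := by
  ext q
  induction q using QuotientGroup.induction_on with
  | H t => exact thetaW₃₄_add W Ψ Ψ' x t

/-- (Ported verbatim from the HodgeCMPerL package; no docstring in the source.) -/
theorem thetaWQ₃₄_smul (a : ℂ) (Ψ : piSchwartzBruhat W.F W.ι) (x : ↥(Adelic.adelicUnitaryGroup L V.Hm)) :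
    thetaWQ₃₄ W (a • Ψ) x = a • thetaWQ₃₄ W Ψ x := by
  ext q
  induction q using QuotientGroup.induction_on with
  | H t => exact thetaW₃₄_smul W a Ψ x t

/-! ## 2. The torus period of the W-block, for every `Ψ ∈ 𝒮(𝔸)` -/

/-- **`torusPeriodW₃₄ W χ Ψ x := ∫_{[U(W₃)]×[U(W₄)]} χ(u₁u₂) · θ^W_Ψ(x, u₁u₂) d(du₁ du₂)`** — the (34) torus period against the character
`χ` of `[T]`, read over the two compact line quotients (PerL (eq:seesaw) currency). -/
def torusPeriodW₃₄ (χ : PontryaginDual (SeesawTorus L⁺ L ⧸ SeesawTorus.rat L⁺ L)) (Ψ : piSchwartzBruhat W.F W.ι)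
    (x : ↥(Adelic.adelicUnitaryGroup L V.Hm)) : ℂ :=
  ∫ p : (relNormOneIdeles L⁺ L ⧸ relNormOneRat L⁺ L) × (relNormOneIdeles L⁺ L ⧸ relNormOneRat L⁺ L),
    dualChar χ (SeesawTorus.quotInl L⁺ L p.1 * SeesawTorus.quotInr L⁺ L p.2) *
      thetaWQ₃₄ W Ψ x (SeesawTorus.quotInl L⁺ L p.1 * SeesawTorus.quotInr L⁺ L p.2)
    ∂((probHaarRelNormOneQuot L⁺ L).prod (probHaarRelNormOneQuot L⁺ L))

/-- the map `(u₁, u₂) ↦ u₁u₂ ∈ [T]` is continuous -/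
theorem continuous_quotInl_mul_quotInr' :
    Continuous fun p : (relNormOneIdeles L⁺ L ⧸ relNormOneRat L⁺ L) × (relNormOneIdeles L⁺ L ⧸ relNormOneRat L⁺ L) =>
      SeesawTorus.quotInl L⁺ L p.1 * SeesawTorus.quotInr L⁺ L p.2 :=
  ((SeesawTorus.continuous_quotInl L⁺ L).comp continuous_fst).mul ((SeesawTorus.continuous_quotInr L⁺ L).comp continuous_snd)

/-- the integrand of `torusPeriodW₃₄` is continuous, hence integrable on the compact `[U(W₃)] × [U(W₄)]` -/
theorem integrable_torusPeriodW₃₄_integrand (χ : PontryaginDual (SeesawTorus L⁺ L ⧸ SeesawTorus.rat L⁺ L))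
    (Ψ : piSchwartzBruhat W.F W.ι) (x : ↥(Adelic.adelicUnitaryGroup L V.Hm)) :
    Integrable (fun p : (relNormOneIdeles L⁺ L ⧸ relNormOneRat L⁺ L) × (relNormOneIdeles L⁺ L ⧸ relNormOneRat L⁺ L) =>
      dualChar χ (SeesawTorus.quotInl L⁺ L p.1 * SeesawTorus.quotInr L⁺ L p.2) *
        thetaWQ₃₄ W Ψ x (SeesawTorus.quotInl L⁺ L p.1 * SeesawTorus.quotInr L⁺ L p.2))
      ((probHaarRelNormOneQuot L⁺ L).prod (probHaarRelNormOneQuot L⁺ L)) := by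
  refine Continuous.integrable_of_hasCompactSupport ?_ (HasCompactSupport.of_compactSpace _)
  exact ((continuous_dualChar χ).comp (continuous_quotInl_mul_quotInr' (L := L))).mul
    ((thetaWQ₃₄ W Ψ x).continuous.comp (continuous_quotInl_mul_quotInr' (L := L)))

/-- (Ported verbatim from the HodgeCMPerL package; no docstring in the source.) -/
theorem torusPeriodW₃₄_add (χ : PontryaginDual (SeesawTorus L⁺ L ⧸ SeesawTorus.rat L⁺ L)) (Ψ Ψ' : piSchwartzBruhat W.F W.ι)
    (x : ↥(Adelic.adelicUnitaryGroup L V.Hm)) :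
    torusPeriodW₃₄ W χ (Ψ + Ψ') x = torusPeriodW₃₄ W χ Ψ x + torusPeriodW₃₄ W χ Ψ' x := by
  unfold torusPeriodW₃₄
  rw [← integral_add (integrable_torusPeriodW₃₄_integrand W χ Ψ x) (integrable_torusPeriodW₃₄_integrand W χ Ψ' x)]
  refine integral_congr_ae (Filter.Eventually.of_forall fun p => ?_)
  simp only [thetaWQ₃₄_add, ContinuousMap.add_apply, mul_add]

/-- (Ported verbatim from the HodgeCMPerL package; no docstring in the source.) -/
theorem torusPeriodW₃₄_smul (χ : PontryaginDual (SeesawTorus L⁺ L ⧸ SeesawTorus.rat L⁺ L)) (a : ℂ)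
    (Ψ : piSchwartzBruhat W.F W.ι) (x : ↥(Adelic.adelicUnitaryGroup L V.Hm)) :
    torusPeriodW₃₄ W χ (a • Ψ) x = a * torusPeriodW₃₄ W χ Ψ x := by
  unfold torusPeriodW₃₄
  rw [← integral_const_mul]
  refine integral_congr_ae (Filter.Eventually.of_forall fun p => ?_)
  simp only [thetaWQ₃₄_smul, ContinuousMap.smul_apply, smul_eq_mul]
  ring

/-- (Ported verbatim from the HodgeCMPerL package; no docstring in the source.) -/
theorem torusPeriodW₃₄_sub (χ : PontryaginDual (SeesawTorus L⁺ L ⧸ SeesawTorus.rat L⁺ L)) (Ψ Ψ' : piSchwartzBruhat W.F W.ι)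
    (x : ↥(Adelic.adelicUnitaryGroup L V.Hm)) :
    torusPeriodW₃₄ W χ (Ψ - Ψ') x = torusPeriodW₃₄ W χ Ψ x - torusPeriodW₃₄ W χ Ψ' x := by
  rw [sub_eq_add_neg, torusPeriodW₃₄_add, ← neg_one_smul ℂ Ψ', torusPeriodW₃₄_smul]
  ring

end General

/-! ## 3. Junction with the END STATE: `ϑc χ Φ (xΓ_U) = ν_T(𝓕_T) • torusPeriodW₃₄ (W V c) χ Φ x` for `Φ ∈ 𝒮^κ` -/

section Pin

open Literature.AlgebraicGeometry.HodgeTheory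
open Literature.NumberTheory.Automorphic.PicardCM
open Literature.NumberTheory.Transcendental (Arapura2012_Cor_15_4_6)

variable (hHD : exists_isReal_hodgeModel) (hI : hodgePQ_independent_of_hodgeModel)
  (h₁ : BallQuotientUniformised)  (h₃ : CMAbelianVarietyRealised)
variable (h : Bool) (hA : Arapura2012_Cor_15_4_6)
  (W : ∀ {L : CMField} {ι₁ : L →+* ℂ} (V : HermSpace3 L ι₁) (c : SeesawCtx L), WmInput V c.D)
  (S : ∀ {L : CMField} {ι₁ : L →+* ℂ} (V : HermSpace3 L ι₁) (c : SeesawCtx L), ThetaAdelicSide V c)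
  (μ : ∀ {L : CMField}, SeesawCtx L → Fin 4 → InfinitePlace L → ℤ)
variable {L : CMField} {ι₁ : L →+* ℂ} (V : HermSpace3 L ι₁) (c : SeesawCtx L)

local notation3 "L⁺" => maximalRealSubfield (L : Type)

/-- The (34) period integrand of the END STATE IS `χ · θ^W` descended (regime of `U(W)`). -/
theorem periodIntegrand₃₄_eq_mul_thetaWQ₃₄ (hW : IsAnisotropic L c.D.gramW)
    (χ : ((pinT hHD hI h₁ h₃ h hA W S μ).t34 V c).X) (Φ : (pinT hHD hI h₁ h₃ h hA W S μ).SK V c)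
    (x : ↥(Adelic.regimeSubgroup L V.Hm)) (q : SeesawTorus L⁺ L ⧸ SeesawTorus.rat L⁺ L) :
    (pinR34 hHD hI h₁ h₃ h hA W S μ V c).periodIntegrand (hΛ₃₄ c) χ Φ (QuotientGroup.mk x) q =
      dualChar χ.1 q * thetaWQ₃₄ (W V c) Φ.1 (x : ↥(Adelic.adelicUnitaryGroup L V.Hm)) q := by
  induction q using QuotientGroup.induction_on with
  | H t => rw [periodIntegrand₃₄_mk hHD hI h₁ h₃ h hA W S μ V c hW χ Φ x t, thetaWQ₃₄_mk, thetaW₃₄_apply]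

/-- **JUNCTION (34)**: for `Φ ∈ 𝒮^κ` and `χ` a character of the side's archimedean type, the END STATE's torus period at `xΓ_U` is the
W-block's torus period: `ϑc χ Φ (xΓ_U) = ν_T(𝓕_T) • torusPeriodW₃₄ (W V c) χ Φ x` — so `(T.t34 V c).ϑ χ Φ = toLp (ξ ↦ …)` reads, value by
value, as a `[U(W₃)] × [U(W₄)]`-period of `Θ(W.ρ(eV x⁻¹, eW (jT₃₄ ·)) Φ)` (PerL (eq:seesaw) currency). -/
theorem t34_ϑc_mk_eq_smul_torusPeriodW₃₄ (hW : IsAnisotropic L c.D.gramW)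
    (χ : ((pinT hHD hI h₁ h₃ h hA W S μ).t34 V c).X) (Φ : (pinT hHD hI h₁ h₃ h hA W S μ).SK V c)
    (x : ↥(Adelic.regimeSubgroup L V.Hm)) :
    (pinR34 hHD hI h₁ h₃ h hA W S μ V c).kt.ϑc χ Φ (QuotientGroup.mk x) =
      (SeesawTorus.haar L⁺ L (SeesawTorus.fundamentalDomain L⁺ L)).toReal •
        torusPeriodW₃₄ (W V c) χ.1 Φ.1 (x : ↥(Adelic.adelicUnitaryGroup L V.Hm)) := by
  rw [t34_ϑc_eq_smul_integral_prod hHD hI h₁ h₃ h hA W S μ V c χ Φ (QuotientGroup.mk x)]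
  congr 1
  unfold torusPeriodW₃₄
  refine integral_congr_ae (Filter.Eventually.of_forall fun p => ?_)
  exact periodIntegrand₃₄_eq_mul_thetaWQ₃₄ hHD hI h₁ h₃ h hA W S μ V c hW χ Φ x _

end Pin

/-! ## 4. (SS₃₄) and the see-saw on pure tensors for `ϑ₃₄` -/

section Seesaw34

open HodgeCM.Model.ThetaSpace HodgeCM.Model.SupplyResidual
open Literature.AlgebraicGeometry.HodgeTheory
open Literature.NumberTheory.Automorphic.PicardCM
open Literature.NumberTheory.Transcendental (Arapura2012_Cor_15_4_6)

variable (hHD : exists_isReal_hodgeModel) (hI : hodgePQ_independent_of_hodgeModel)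
  (h₁ : BallQuotientUniformised)  (h₃ : CMAbelianVarietyRealised)
variable (h : Bool) (hA : Arapura2012_Cor_15_4_6)
  (W : ∀ {L : CMField} {ι₁ : L →+* ℂ} (V : HermSpace3 L ι₁) (c : SeesawCtx L), WmInput V c.D)
  (S : ∀ {L : CMField} {ι₁ : L →+* ℂ} (V : HermSpace3 L ι₁) (c : SeesawCtx L), ThetaAdelicSide V c)
  (μ : ∀ {L : CMField}, SeesawCtx L → Fin 4 → InfinitePlace L → ℤ)
variable {L : CMField} {ι₁ : L →+* ℂ} (V : HermSpace3 L ι₁) (c : SeesawCtx L) (hV : IsAnisotropic L V.Hm)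

local notation3 "L⁺" => maximalRealSubfield (L : Type)
local notation3 "𝕏" => pinX hHD hI h₁ h₃ S V c hV
local notation3 "𝕌" => (↥(Literature.NumberTheory.Automorphic.relNormOneIdeles (𝕏).K (𝕏).L) ⧸
  Literature.NumberTheory.Automorphic.relNormOneRat (𝕏).K (𝕏).L)
local notation3 "d𝕌" => Literature.NumberTheory.Automorphic.probHaarRelNormOneQuot (𝕏).K (𝕏).L

/-- **The (34) see-saw hypotheses at the context `(V, c)`** — a HYPOTHESIS record, never asserted. -/
structure SeesawHyp34 where
  /-- the pure tensor of two small test functions (lines `W₃`, `W₄`), read in the W-block's Schwartz–Bruhat space -/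
  τ : piSchwartzBruhat L⁺ (Fin 3) → piSchwartzBruhat L⁺ (Fin 3) → piSchwartzBruhat (W V c).F (W V c).ι
  /-- (SS₃₄) the restriction identity at Θ-values along `eV` / `eW ∘ jT₃₄` for the CONJUGATED pair (lines `k = 2, 3` of (S-restr)) -/
  seesaw : ∀ (g : ↥(Adelic.regimeSubgroup L V.Hm)) (t : SeesawTorus L⁺ L) (φ₂ φ₃ : piSchwartzBruhat L⁺ (Fin 3)),
    thetaDistLM (W V c).F (W V c).ι
        ((((W V c).ρ ((W V c).eV (g : ↥(Adelic.adelicUnitaryGroup L V.Hm)), (W V c).eW (c.D.jT₃₄ t))) :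
          Module.End ℂ (piSchwartzBruhat (W V c).F (W V c).ι)) (τ φ₂ φ₃)) =
      thetaDistLM L⁺ (Fin 3) (((S V c).P 2).ω (g, SeesawTorus.fst L⁺ L t) φ₂) *
        thetaDistLM L⁺ (Fin 3) (((S V c).P 3).ω (g, SeesawTorus.snd L⁺ L t) φ₃)

/-- **(SS₃₄) integrated**: the product of the two `[U(1)]`-periods of lines `3`, `4` is `torusPeriodW₃₄ (W V c) (χ₂ ⊠ χ₃) (τ φ₂ φ₃) x`. -/
theorem integral_mul_integral_eq_torusPeriodW₃₄ (H : SeesawHyp34 W S V c)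
    (φ₂ φ₃ : piSchwartzBruhat (𝕏).K (Fin 3)) (χ₂ χ₃ : PontryaginDual 𝕌) (x : ↥(Adelic.regimeSubgroup L V.Hm)) :
    (∫ q, ((𝕏).P 2).kernelDatum.thetaKer (((𝕏).P 2).weilDatum.toThetaTop φ₂) (QuotientGroup.mk x, q⁻¹) *
        ((χ₂ q : Circle) : ℂ) ∂d𝕌) *
      (∫ q, ((𝕏).P 3).kernelDatum.thetaKer (((𝕏).P 3).weilDatum.toThetaTop φ₃) (QuotientGroup.mk x, q⁻¹) *
        ((χ₃ q : Circle) : ℂ) ∂d𝕌) =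
      torusPeriodW₃₄ (W V c) (SeesawTorus.charPair χ₂ χ₃) (H.τ φ₂ φ₃) (x : ↥(Adelic.adelicUnitaryGroup L V.Hm)) := by
  rw [← integral_prod_mul]
  unfold torusPeriodW₃₄
  refine integral_congr_ae (Filter.Eventually.of_forall fun p => ?_)
  obtain ⟨q₁, q₂⟩ := p
  induction q₁ using QuotientGroup.induction_on with
  | H u₁ =>
    induction q₂ using QuotientGroup.induction_on with
    | H u₂ =>
      have k0 : ((𝕏).P 2).kernelDatum.thetaKer (((𝕏).P 2).weilDatum.toThetaTop φ₂)
            (QuotientGroup.mk x, (QuotientGroup.mk u₁ : 𝕌)⁻¹) =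
          thetaDistLM (𝕏).K (Fin 3) (((𝕏).P 2).ω (x⁻¹, u₁) φ₂) := thetaKer_mk_inv hHD hI h₁ h₃ S V c hV 2 φ₂ x u₁
      have k1 : ((𝕏).P 3).kernelDatum.thetaKer (((𝕏).P 3).weilDatum.toThetaTop φ₃)
            (QuotientGroup.mk x, (QuotientGroup.mk u₂ : 𝕌)⁻¹) =
          thetaDistLM (𝕏).K (Fin 3) (((𝕏).P 3).ω (x⁻¹, u₂) φ₃) := thetaKer_mk_inv hHD hI h₁ h₃ S V c hV 3 φ₃ x u₂
      have kc : dualChar (SeesawTorus.charPair χ₂ χ₃)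
            (SeesawTorus.quotInl L⁺ L (QuotientGroup.mk u₁) * SeesawTorus.quotInr L⁺ L (QuotientGroup.mk u₂)) =
          ((χ₂ (QuotientGroup.mk u₁) : Circle) : ℂ) * ((χ₃ (QuotientGroup.mk u₂) : Circle) : ℂ) :=
        SeesawTorus.toComplexChar_charPair_inl_mul_inr χ₂ χ₃ _ _
      have kw : thetaWQ₃₄ (W V c) (H.τ φ₂ φ₃) (x : ↥(Adelic.adelicUnitaryGroup L V.Hm))
            (SeesawTorus.quotInl L⁺ L (QuotientGroup.mk u₁) * SeesawTorus.quotInr L⁺ L (QuotientGroup.mk u₂)) =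
          thetaDistLM (W V c).F (W V c).ι
            ((((W V c).ρ ((W V c).eV ((x : ↥(Adelic.adelicUnitaryGroup L V.Hm)))⁻¹,
                (W V c).eW (c.D.jT₃₄ (SeesawTorus.mk L⁺ L u₁ u₂)))) :
              Module.End ℂ (piSchwartzBruhat (W V c).F (W V c).ι)) (H.τ φ₂ φ₃)) := by
        rw [quotInl_mk_mul_quotInr_mk, thetaWQ₃₄_mk, thetaW₃₄_apply]
      have hs : thetaDistLM (W V c).F (W V c).ι
            ((((W V c).ρ ((W V c).eV ((x : ↥(Adelic.adelicUnitaryGroup L V.Hm)))⁻¹,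
                (W V c).eW (c.D.jT₃₄ (SeesawTorus.mk L⁺ L u₁ u₂)))) :
              Module.End ℂ (piSchwartzBruhat (W V c).F (W V c).ι)) (H.τ φ₂ φ₃)) =
          thetaDistLM (𝕏).K (Fin 3) (((𝕏).P 2).ω (x⁻¹, u₁) φ₂) * thetaDistLM (𝕏).K (Fin 3) (((𝕏).P 3).ω (x⁻¹, u₂) φ₃) :=
        H.seesaw x⁻¹ (SeesawTorus.mk L⁺ L u₁ u₂) φ₂ φ₃
      show ((𝕏).P 2).kernelDatum.thetaKer (((𝕏).P 2).weilDatum.toThetaTop φ₂) (QuotientGroup.mk x, (QuotientGroup.mk u₁ : 𝕌)⁻¹) *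
            ((χ₂ (QuotientGroup.mk u₁) : Circle) : ℂ) *
          (((𝕏).P 3).kernelDatum.thetaKer (((𝕏).P 3).weilDatum.toThetaTop φ₃) (QuotientGroup.mk x, (QuotientGroup.mk u₂ : 𝕌)⁻¹) *
            ((χ₃ (QuotientGroup.mk u₂) : Circle) : ℂ)) =
        dualChar (SeesawTorus.charPair χ₂ χ₃)
            (SeesawTorus.quotInl L⁺ L (QuotientGroup.mk u₁) * SeesawTorus.quotInr L⁺ L (QuotientGroup.mk u₂)) *
          thetaWQ₃₄ (W V c) (H.τ φ₂ φ₃) (x : ↥(Adelic.adelicUnitaryGroup L V.Hm))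
            (SeesawTorus.quotInl L⁺ L (QuotientGroup.mk u₁) * SeesawTorus.quotInr L⁺ L (QuotientGroup.mk u₂))
      calc _ = thetaDistLM (𝕏).K (Fin 3) (((𝕏).P 2).ω (x⁻¹, u₁) φ₂) * ((χ₂ (QuotientGroup.mk u₁) : Circle) : ℂ) *
            (thetaDistLM (𝕏).K (Fin 3) (((𝕏).P 3).ω (x⁻¹, u₂) φ₃) * ((χ₃ (QuotientGroup.mk u₂) : Circle) : ℂ)) :=
          congrArg₂ (· * ·) (congrArg (· * ((χ₂ (QuotientGroup.mk u₁) : Circle) : ℂ)) k0)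
            (congrArg (· * ((χ₃ (QuotientGroup.mk u₂) : Circle) : ℂ)) k1)
        _ = ((χ₂ (QuotientGroup.mk u₁) : Circle) : ℂ) * ((χ₃ (QuotientGroup.mk u₂) : Circle) : ℂ) *
            (thetaDistLM (𝕏).K (Fin 3) (((𝕏).P 2).ω (x⁻¹, u₁) φ₂) * thetaDistLM (𝕏).K (Fin 3) (((𝕏).P 3).ω (x⁻¹, u₂) φ₃)) := by
          ring
        _ = _ := (congrArg₂ (· * ·) kc (kw.trans hs)).symm

set_option maxHeartbeats 1600000 in
/-- **The see-saw on PURE TENSORS for E's (34) generator** (the «(eq:seesaw) on pure tensors» input of `QautCore.decomp`, PerL ll. 356–364):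
for `Φ = τ φ₂ φ₃ ∈ 𝒮^κ` and `χ = χ₂ ⊠ χ₃` of the (34) type, at every `xΓ_U`,
`ϑc₃₄ χ Φ (xΓ_U) = ν_T(𝓕_T) · (∫ θ_φ₂(xΓ_U, q⁻¹) χ₂(q) dq) · (∫ θ_φ₃(xΓ_U, q⁻¹) χ₃(q) dq)`; by kit #5 `coord_thetaForm_eq_integral` (any
`k`) the two factors are coordinates at `x⁻¹` of generating theta forms `θ(j₂, charInv χ₂)`, `θ(j₃, charInv χ₃)` of types `2`, `3`. -/
theorem t34_ϑc_mk_eq_smul_integral_mul_integral (hW : IsAnisotropic L c.D.gramW) (H : SeesawHyp34 W S V c)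
    (φ₂ φ₃ : piSchwartzBruhat (𝕏).K (Fin 3)) (χ₂ χ₃ : PontryaginDual 𝕌) (hSK : H.τ φ₂ φ₃ ∈ (W V c).SK)
    (hX : SeesawTorus.charPair χ₂ χ₃ ∈ SeesawTorus.allowedChars (L : Type) (d34Of μ c).m₁ (d34Of μ c).m₂)
    (x : ↥(Adelic.regimeSubgroup L V.Hm)) :
    (pinR34 hHD hI h₁ h₃ h hA W S μ V c).kt.ϑc
        (⟨SeesawTorus.charPair χ₂ χ₃, hX⟩ : ((pinT hHD hI h₁ h₃ h hA W S μ).t34 V c).X)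
        (⟨H.τ φ₂ φ₃, hSK⟩ : (pinT hHD hI h₁ h₃ h hA W S μ).SK V c) (QuotientGroup.mk x) =
      (((SeesawTorus.haar L⁺ L (SeesawTorus.fundamentalDomain L⁺ L)).toReal : ℝ) : ℂ) *
        ((∫ q, ((𝕏).P 2).kernelDatum.thetaKer (((𝕏).P 2).weilDatum.toThetaTop φ₂) (QuotientGroup.mk x, q⁻¹) *
            ((χ₂ q : Circle) : ℂ) ∂d𝕌) *
          (∫ q, ((𝕏).P 3).kernelDatum.thetaKer (((𝕏).P 3).weilDatum.toThetaTop φ₃) (QuotientGroup.mk x, q⁻¹) *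
            ((χ₃ q : Circle) : ℂ) ∂d𝕌)) :=
  ((t34_ϑc_mk_eq_smul_torusPeriodW₃₄ hHD hI h₁ h₃ h hA W S μ V c hW
      (⟨SeesawTorus.charPair χ₂ χ₃, hX⟩ : ((pinT hHD hI h₁ h₃ h hA W S μ).t34 V c).X)
      (⟨H.τ φ₂ φ₃, hSK⟩ : (pinT hHD hI h₁ h₃ h hA W S μ).SK V c) x).trans Complex.real_smul).trans
    (congrArg (fun z : ℂ => (((SeesawTorus.haar L⁺ L (SeesawTorus.fundamentalDomain L⁺ L)).toReal : ℝ) : ℂ) * z)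
      (integral_mul_integral_eq_torusPeriodW₃₄ hHD hI h₁ h₃ W S V c hV H φ₂ φ₃ χ₂ χ₃ x).symm)

end Seesaw34

end HodgeCM.Model

end
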